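/-
Literature/AlgebraicGeometry/Pohlmann1968/DegenerateCMTypesAbelianCMFieldExponentTwiceOdd.lean — pub-hodgecm2 (COR-CM), KEPT Literature
lane lit-deligne-3 gen 66, file F66f.  THEOREMS ONLY (no `def`, no named fact, no `sorry`, no instance, no notation; D-0026 net debt 0).
HC_CM is NOT proved.
-/
import Literature.AlgebraicGeometry.Pohlmann1968.DegenerateCMTypesAbelianCMFieldMixedDifferencesSubfields
import Literature.NumberTheory.ComplexMultiplication.DegenerateCMTypesAbelianKernelsExponentTwiceOdd
import HarnessLib

/-!
# ABELIAN CM fields with `g^{2m} = 1` on `Gal(K/ℚ)`, `m` ODD ARBITRARY: the rank of every CM type ON THE LATTICE OF SUBFIELDS,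
# `Rank(Φ) + b(Φ) + Σ_{d ∣ m, d ≠ 1} φ(2d)·s_d(Φ) = [K:ℚ]/2 + 1`; the nondegeneracy criterion; the Hodge conjecture for all powers off the
# lists; `ℚ(ζ₁₂₇)`, `ℚ(ζ₁₅₁)`, `ℚ(ζ₂₀₉)`, `ℚ(ζ₃₂₄)`

Topic `Literature/AlgebraicGeometry/Pohlmann1968` (namespace `Literature.AlgebraicGeometry.Pohlmann1968.ExponentTwiceOdd`); cell `pub-hodgecm2` (COR-CM),
KEPT Literature lane `lit-deligne-3` gen 66, file F66f — the FIELD-LEVEL synthesis of the lane's ARBITRARY-ODD-PART programme: the group-level F66e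
(`CyclicCMType.AbelianKernels.typeRank_add_card_add_sum_divisors_totient_mul_card_eq`) transferred to abelian CM fields and read on the lattice of subfields
by the lane's general dictionary F66a (`MixedDifferencesReading.card_index_isCyclic_eq_ncard_mixed`).  It SUBSUMES the lane's exponent files `2p` (F64a),
`2p²` (F64c), `2pq` (F65a), `2m` squarefree (F65i ∕ F66a §2): the index classes are the divisors `d ≠ 1` of `m`, the class-`d` subfields are the CM subfields
of degree `2d` WITH CYCLIC GALOIS GROUP over which the type has vanishing mixed differences along the prime torsion.  KERNEL ONLY: theorems; no `def`, no
named fact, no instance, no notation (D-0014 ∕ D-0026 net debt `0`).  HC_CM is NOT proved here or anywhere in the lane.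

## Mathematics

Let `K` be a CM field, abelian over `ℚ`, with `g^{2m} = 1` on `G = Gal(K/ℚ)` (`m` odd), `ρ` = complex conjugation, `Φ` a CM type, `S = {g : φ₀ ∘ g⁻¹ ∈ Φ}`.
Kubota's defect [Kubota1965, §4 Lemma 2] regrouped by kernels (White): `Rank(Φ) + Σ_H φ([G:H]) = [K:ℚ]/2 + 1` over the admissible kernels `H ∌ ρ`, `G/H`
cyclic, all characters of kernel `H` vanishing on `S`; an admissible kernel has index `2d`, `d ∣ m`; the class `d = 1` is Weil type over the imaginary
quadratic `K^H` ([Dodson1984] §3.1.1), the class `d ≠ 1` is decided by the lane's F66c ([Hazama2003CyclicCM] Lemma 4.6.1 mechanism with multiplicities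
+ the Rédei ∕ de Bruijn ∕ Schoenberg relations for arbitrary order [LamLeung2000] Thm. 2.2): vanishing of the mixed differences
`Σ_{ε ∈ {0,1}^{primes(d)}} (−1)^{|ε|} #(S ∩ g·Π_{ε_q=1} x_q·H)` for all `g` and all `x_q` with `x_q^q ∈ H`.  Through the Galois correspondence
([Yanai2015IndexDegeneracy] Thm. 4.1; the lane's dictionary `forall_sum_card_filter_eq_zero_iff_mixed`): `H = Gal(K/F)`, `F` a CM subfield of degree `2d`
with `Gal(F/ℚ)` cyclic, and the condition reads — for every family `σ_q ∈ Gal(F/ℚ)` (`q ∣ d` prime) with `σ_q^q = 1` and every `τ : F → ℂ`,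
`Σ_ε (−1)^{|ε|} #{φ ∈ Φ : φ|_F = τ ∘ Π_{ε_q=1} σ_q} = 0`.  Hence (**`cmTypeRank_add_ncard_subfields_eq`**)

  `Rank(Φ) + b(Φ) + Σ_{d ∣ m, d ≠ 1} φ(2d) · s_d(Φ) = [K:ℚ]/2 + 1`,

`b(Φ)` = the imaginary quadratic subfields over which `Φ` is of Weil type, `s_d(Φ)` = the CM subfields `F` of degree `2d`, `Gal(F/ℚ)` cyclic, over which `Φ`
has vanishing mixed differences along the prime torsion; `Φ` is NONDEGENERATE iff all these sets are empty (**`isNondegenerate_iff_forall_intermediateField`**),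
and then `B•(Aⁿ) ⊗ ℂ = D•(Aⁿ) ⊗ ℂ` and the Hodge conjecture hold for all powers of every abelian variety of type `(K; Φ)` (Pohlmann ∕ Hazama; tree
`IsNondegenerate.hodgeClassSpan_pow_eq_divisorClassesSpan`).

* §1 on `Gal(K/ℚ)`: `cmTypeRank_add_card_add_sum_divisors_totient_mul_card_eq` (F66e transferred along `galType`).
* §2 on subfields: **`cmTypeRank_add_ncard_subfields_eq`**, **`isNondegenerate_iff_forall_intermediateField`**, `not_isNondegenerate_of_mixed_of_isCyclic`.
* §3 abelian varieties: `hodgeClassSpan_pow_eq_divisorClassesSpan_of_forall_intermediateField`, **`hodgeConjectureFor_pow_of_forall_intermediateField`**.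
* §4 cyclotomic fields `ℚ(ζ_N)` with `u^{2m} = 1` on `(ℤ/N)ˣ`, `m` odd (`…_of_isCyclotomicExtension`), and the first levels whose odd exponent part is
  NEITHER squarefree NOR a prime square (new to the lane): `ℚ(ζ₁₂₇)` (`Gal ≅ ℤ/126`, `m = 63 = 3²·7`), `ℚ(ζ₁₅₁)` (`ℤ/150`, `m = 75 = 3·5²`),
  `ℚ(ζ₂₀₉)` (`ℤ/10 × ℤ/18`, exponent `90`, `m = 45`), `ℚ(ζ₃₂₄)` (`ℤ/2 × ℤ/54`, exponent `54`, `m = 27 = 3³`): `units_pow_…` by kernel decision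
  on residues and **`hodgeConjectureFor_pow_of_forall_intermediateField_…`**.

PRESEARCH (lane rule): as for F65i ∕ F66a ∕ F66e (corpus hybrid «rank CM type abelian CM field subfields mixed differences divisors», vector «nondegenerate
CM type criterion on subfields of an abelian CM field», galaxy «degenerate CM type | rank of a CM-type | index of degeneracy», all stars): the cyclic case
is [Hazama2003CyclicCM] Thm. 4.8 (criterion by levels over the subfields of a CYCLIC CM field); the general abelian statement with divisor classes and
the cyclic-Galois clause is not found as printed; recorded as the lane's own elementary theorem with the citations above.

HONEST REGISTER.  Unconditional given the tree; exponent `2m` with `m` odd only (`2`-part of the exponent exactly `2`; `4m` needs the index-`4d` classes,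
not treated for non-squarefree `m`); nothing is claimed about the Hodge classes of DEGENERATE types.  HC_CM is NOT proved and not used.

## References

* [Kubota1965] T. Kubota, *On the field extension by complex multiplication*, Trans. AMS 118 (1965), §4 Lemma 2.
* [White1993SporadicCycles] S. P. White, *Sporadic cycles on CM abelian varieties*, Compositio Math. 88 (1993), §4, proof of Lemma 3 (p. 131).
* [Dodson1984] B. Dodson, *The structure of Galois groups of CM-fields*, Trans. AMS 283 (1984), §3.1.1 Theorem.
* [Hazama2003CyclicCM] F. Hazama, *Hodge cycles on abelian varieties with complex multiplication by cyclic CM-fields*, J. Math. Sci. Univ. Tokyo 10 (2003):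
  Prop. 4.3, Lemma 4.6.1, Thm. 4.8.
* [LamLeung2000] T. Y. Lam, K. H. Leung, *On vanishing sums of roots of unity*, J. Algebra 224 (2000), Thm. 2.2.
* [Yanai2015IndexDegeneracy] H. Yanai, *On degenerate CM-types*, J. Number Theory 152 (2015), Thm. 4.1 (proof, p. 818).
* [Gordon1999HodgeAVSurvey] B. B. Gordon, *A survey of the Hodge conjecture for abelian varieties* (1999), Thm. 6.4, §9.3.
* [Washington1997] L. C. Washington, *Introduction to cyclotomic fields*, 2nd ed. (1997), Ch. 2 Thm. 2.5.

## Provenance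

Cell `pub-hodgecm2` (COR-CM), KEPT Literature lane `lit-deligne-3` gen 66 (claim ABELIAN-EXPONENT-2ODD-FIELD; count-neutral, own lane), file F66f; neighbours
cited by name, nothing restated: `DegenerateCMTypesAbelianKernelsExponentTwiceOdd` (F66e), `DegenerateCMTypesAbelianCMFieldMixedDifferencesSubfields` (F66a:
`card_index_isCyclic_eq_ncard_mixed`, `forall_subgroup_isCyclic_iff_forall_intermediateField_mixed`), `DegenerateCMTypesAbelianCMFieldCyclicSubfields`
(`card_indexTwo_eq_ncard_weilQuadratic`, `card_filter_mem_eq_iff_balanced`), `ExponentFourTimesPrime.cm_abelian_pow_eq_one_of_isCyclotomicExtension`.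
Theorems only; net Literature debt 0.
-/

noncomputable section

open scoped BigOperators NumberField IsMulCommutative Classical
open NumberField IntermediateField

namespace Literature.AlgebraicGeometry.Pohlmann1968

namespace ExponentTwiceOdd

open Literature.NumberTheory.ComplexMultiplication
open Literature.NumberTheory.ComplexMultiplication.CMNumbers
open Literature.AlgebraicGeometry.Motives (CMType)
open Literature.AlgebraicGeometry.Pohlmann1968.CyclicTwoOddPrimes (isCMTypeWith_galType cmTypeRank_eq_typeRank_galType)
open Literature.AlgebraicGeometry.Pohlmann1968.AbelianKernels
open Literature.AlgebraicGeometry.Pohlmann1968.MixedDifferencesReading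
open Literature.AlgebraicGeometry.Pohlmann1968.ExponentFourTimesPrime (cm_abelian_pow_eq_one_of_isCyclotomicExtension)

/-! ## §1 On `Gal(K/ℚ)`: the defect by divisor classes -/

section Field

variable {K : Type} [Field K] [NumberField K] [IsCMField K] [IsAbelianGalois ℚ K] {m : ℕ}

/-- **The defect on `Gal(K/ℚ)` for an abelian CM field with `g^{2m} = 1`, `m` odd** (`S = {g : φ₀ ∘ g⁻¹ ∈ Φ}`, `ρ` = complex conjugation):
`Rank(Φ) + #B₂ + Σ_{d ∣ m, d ≠ 1} φ(2d)·#B_d = [K:ℚ]/2 + 1`, `B_d` = subgroups `H ∌ ρ` of index `2d` with cyclic quotient at which the mixed differences of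
the coset counts of `S` along the prime torsion vanish — the lane's group-level F66e read on `Gal(K/ℚ)`. [cite: Kubota1965, §4 Lemma 2]
[cite: Hazama2003CyclicCM, Prop. 4.3 and Thm. 4.8] [cite: Dodson1984, §3.1.1 Theorem] [cite: LamLeung2000, Thm. 2.2] -/
theorem cmTypeRank_add_card_add_sum_divisors_totient_mul_card_eq (hodd : ¬ 2 ∣ m) (φ₀ : K →+* ℂ)
    (hexp : ∀ g : K ≃ₐ[ℚ] K, g ^ (2 * m) = 1) (Φ : CMType K) :
    cmTypeRank Φ +
      ((Finset.univ : Finset (Subgroup (K ≃ₐ[ℚ] K))).filter fun H =>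
        (conjGal : K ≃ₐ[ℚ] K) ∉ H ∧ H.index = 2 ∧
        ((Finset.univ.filter fun g : K ≃ₐ[ℚ] K => embOf φ₀ g ∈ Φ.1).filter fun s => s ∈ H).card =
          ((Finset.univ.filter fun g : K ≃ₐ[ℚ] K => embOf φ₀ g ∈ Φ.1).filter fun s => s ∉ H).card).card +
      ∑ d ∈ m.divisors.erase 1,
        (2 * d).totient *
          ((Finset.univ : Finset (Subgroup (K ≃ₐ[ℚ] K))).filter fun H => (conjGal : K ≃ₐ[ℚ] K) ∉ H ∧ H.index = 2 * d ∧
            IsCyclic ((K ≃ₐ[ℚ] K) ⧸ H) ∧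
            ∀ (g : K ≃ₐ[ℚ] K) (x : ↥d.primeFactors → (K ≃ₐ[ℚ] K)), (∀ q, x q ^ (q : ℕ) ∈ H) →
              ∑ ε : ↥d.primeFactors → Bool, (∏ q, (if ε q then (-1 : ℤ) else 1)) *
                (((Finset.univ.filter fun g : K ≃ₐ[ℚ] K => embOf φ₀ g ∈ Φ.1).filter
                  fun s => (g * ∏ q, (if ε q then x q else 1))⁻¹ * s ∈ H).card : ℤ) = 0).card =
      Module.finrank ℚ K / 2 + 1 := by
  rw [cmTypeRank_eq_typeRank_galType Φ φ₀, ← card_gal_eq_finrank φ₀]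
  exact CyclicCMType.AbelianKernels.typeRank_add_card_add_sum_divisors_totient_mul_card_eq hodd
    (isCMTypeWith_galType (AbelianCMFieldExistence.apply_conjGal_eq φ₀) Φ) hexp

end Field

/-! ## §2 On the lattice of subfields: the intrinsic rank formula and the nondegeneracy criterion -/

section Subfields

variable {K : Type} [Field K] [NumberField K] [IsCMField K] [IsAbelianGalois ℚ K] {m : ℕ}

/-- **THE RANK OF A CM TYPE OF AN ABELIAN CM FIELD WITH `g^{2m} = 1` ON `Gal(K/ℚ)`, `m` ODD, ON THE LATTICE OF SUBFIELDS.**  For ANY CM type `Φ` of `K`,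

  `Rank(Φ) + b(Φ) + Σ_{d ∣ m, d ≠ 1} φ(2d) · s_d(Φ) = [K:ℚ]/2 + 1`,

where `b(Φ)` = the imaginary quadratic subfields over which `Φ` is of Weil type and `s_d(Φ)` = the CM subfields `F ⊆ K` of degree `2d` WITH `Gal(F/ℚ)`
CYCLIC over which `Φ` has VANISHING MIXED DIFFERENCES ALONG THE PRIME TORSION: for every family `σ_q ∈ Gal(F/ℚ)` (`q ∣ d` prime) with `σ_q^q = 1` and
every `τ : F → ℂ`, `Σ_{ε ∈ {0,1}^{primes(d)}} (−1)^{|ε|} #{φ ∈ Φ : φ|_F = τ ∘ Π_{ε_q = 1} σ_q} = 0` (`d = p`: `Φ` level of exponent `p` over `F`;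
`d = pq`: additively separable).  Kubota's defect regrouped by kernels (White), every divisor class decided (Dodson; Hazama's mechanism with multiplicities;
the relations of Rédei ∕ de Bruijn ∕ Schoenberg), read through the Galois correspondence (Yanai).  The squarefree case is the lane's F66a §2, the cases
`m = p, p², pq` its F64a, F64c, F65a. [cite: Kubota1965, §4 Lemma 2] [cite: Hazama2003CyclicCM, Prop. 4.3 and Thm. 4.8] [cite: Dodson1984, §3.1.1 Theorem]
[cite: LamLeung2000, Thm. 2.2] [cite: Yanai2015IndexDegeneracy, Thm. 4.1 (proof, p. 818)] -/
theorem cmTypeRank_add_ncard_subfields_eq (hodd : ¬ 2 ∣ m) (hexp : ∀ g : K ≃ₐ[ℚ] K, g ^ (2 * m) = 1) (Φ : CMType K) :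
    cmTypeRank Φ + {F : IntermediateField ℚ K | Module.finrank ℚ F = 2 ∧ ¬ IsTotallyReal F ∧
        ∀ τ : F →+* ℂ, {φ : K →+* ℂ | φ.comp (algebraMap F K) = τ ∧ φ ∈ Φ.1}.ncard =
          {φ : K →+* ℂ | φ.comp (algebraMap F K) = τ ∧ φ ∉ Φ.1}.ncard}.ncard +
      ∑ d ∈ m.divisors.erase 1,
        (2 * d).totient *
          {F : IntermediateField ℚ K | Module.finrank ℚ F = 2 * d ∧ ¬ IsTotallyReal F ∧ IsCyclic (F ≃ₐ[ℚ] F) ∧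
            ∀ [IsAbelianGalois ℚ F] (σ : ↥d.primeFactors → (F ≃ₐ[ℚ] F)), (∀ q, σ q ^ (q : ℕ) = 1) → ∀ τ : F →+* ℂ,
              ∑ ε : ↥d.primeFactors → Bool, (∏ q, (if ε q then (-1 : ℤ) else 1)) *
                ({φ : K →+* ℂ | φ.comp (algebraMap F K) = τ.comp (∏ q, (if ε q then σ q else 1)).toRingEquiv.toRingHom ∧
                  φ ∈ Φ.1}.ncard : ℤ) = 0}.ncard = Module.finrank ℚ K / 2 + 1 := by
  obtain ⟨φ₀⟩ := (inferInstance : Nonempty (K →+* ℂ))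
  rw [← card_indexTwo_eq_ncard_weilQuadratic φ₀ Φ, ← cmTypeRank_add_card_add_sum_divisors_totient_mul_card_eq hodd φ₀ hexp Φ]
  congr 1
  refine Finset.sum_congr rfl fun d _ => ?_
  rw [card_index_isCyclic_eq_ncard_mixed φ₀ Φ (fun q : ↥d.primeFactors => (q : ℕ)) (2 * d)]

/-- **NONDEGENERACY CRITERION ON THE LATTICE OF SUBFIELDS (`g^{2m} = 1` on `Gal(K/ℚ)`, `m` odd).**  `Φ` is NONDEGENERATE iff (i) it is of Weil type over NO
imaginary quadratic subfield and (ii) for every divisor `d ≠ 1` of `m`, over NO CM subfield `F` of degree `2d` with `Gal(F/ℚ)` cyclic do all the mixed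
differences of the multiplicities of `Φ|_F` along the prime torsion vanish. [cite: Kubota1965, §4 Lemma 2] [cite: Hazama2003CyclicCM, Prop. 4.3 and Thm. 4.8]
[cite: Dodson1984, §3.1.1 Theorem] [cite: Yanai2015IndexDegeneracy, Thm. 4.1] -/
theorem isNondegenerate_iff_forall_intermediateField (hodd : ¬ 2 ∣ m) (hexp : ∀ g : K ≃ₐ[ℚ] K, g ^ (2 * m) = 1) (Φ : CMType K) :
    IsNondegenerate Φ ↔
      (∀ F : IntermediateField ℚ K, Module.finrank ℚ F = 2 → ¬ IsTotallyReal F →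
        ¬ ∀ τ : F →+* ℂ, {φ : K →+* ℂ | φ.comp (algebraMap F K) = τ ∧ φ ∈ Φ.1}.ncard =
          {φ : K →+* ℂ | φ.comp (algebraMap F K) = τ ∧ φ ∉ Φ.1}.ncard) ∧
      ∀ d : ℕ, d ∣ m → d ≠ 1 → ∀ F : IntermediateField ℚ K, Module.finrank ℚ F = 2 * d → ¬ IsTotallyReal F → IsCyclic (F ≃ₐ[ℚ] F) →
        ∀ [IsAbelianGalois ℚ F],
        ¬ ∀ σ : ↥d.primeFactors → (F ≃ₐ[ℚ] F), (∀ q, σ q ^ (q : ℕ) = 1) → ∀ τ : F →+* ℂ,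
          ∑ ε : ↥d.primeFactors → Bool, (∏ q, (if ε q then (-1 : ℤ) else 1)) *
            ({φ : K →+* ℂ | φ.comp (algebraMap F K) = τ.comp (∏ q, (if ε q then σ q else 1)).toRingEquiv.toRingHom ∧
              φ ∈ Φ.1}.ncard : ℤ) = 0 := by
  obtain ⟨φ₀⟩ := (inferInstance : Nonempty (K →+* ℂ))
  rw [Pohlmann1968.isNondegenerate_iff Φ, cmTypeRank_eq_typeRank_galType Φ φ₀, ← card_gal_eq_finrank φ₀,
    CyclicCMType.AbelianKernels.typeRank_eq_iff_of_exponent_two_mul_odd hodd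
      (isCMTypeWith_galType (AbelianCMFieldExistence.apply_conjGal_eq φ₀) Φ) hexp]
  refine and_congr ?_ (forall_congr' fun d => forall_congr' fun _ => forall_congr' fun _ => ?_)
  · constructor
    · intro h F h2 hF hW
      have hρH : (conjGal : K ≃ₐ[ℚ] K) ∉ F.fixingSubgroup := (conjGal_not_mem_fixingSubgroup_iff F).2 hF
      exact h F.fixingSubgroup hρH (index_fixingSubgroup_eq_two F h2) ((card_filter_mem_eq_iff_balanced φ₀ Φ F h2 hF).2 hW)
    · intro h H hρH hidx hsplit
      have h2 : Module.finrank ℚ (fixedField H) = 2 := by rw [← index_eq_finrank_fixedField, hidx]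
      have hF : ¬ IsTotallyReal (fixedField H) := (conjGal_not_mem_iff_not_isTotallyReal_fixedField H).1 hρH
      refine h (fixedField H) h2 hF ((card_filter_mem_eq_iff_balanced φ₀ Φ (fixedField H) h2 hF).1 ?_)
      simpa only [fixingSubgroup_fixedField] using hsplit
  · exact forall_subgroup_isCyclic_iff_forall_intermediateField_mixed φ₀ Φ (fun q : ↥d.primeFactors => (q : ℕ)) (2 * d)

/-- **Conversely: a CM subfield `F` of degree `2d` (`d ∣ m`, `d ≠ 1`) with `Gal(F/ℚ)` cyclic over which all the mixed differences of `Φ|_F` along the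
prime torsion vanish makes the type DEGENERATE** (it costs `φ(2d)` in rank). [cite: Kubota1965, §4 Lemma 2] [cite: Hazama2003CyclicCM, Thm. 4.8] -/
theorem not_isNondegenerate_of_mixed_of_isCyclic (hodd : ¬ 2 ∣ m) (hexp : ∀ g : K ≃ₐ[ℚ] K, g ^ (2 * m) = 1) (Φ : CMType K) {d : ℕ}
    (hd : d ∣ m) (hd1 : d ≠ 1) (F : IntermediateField ℚ K) [IsAbelianGalois ℚ F] (hdeg : Module.finrank ℚ F = 2 * d) (hF : ¬ IsTotallyReal F)
    (hcyc : IsCyclic (F ≃ₐ[ℚ] F))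
    (hS : ∀ σ : ↥d.primeFactors → (F ≃ₐ[ℚ] F), (∀ q, σ q ^ (q : ℕ) = 1) → ∀ τ : F →+* ℂ,
          ∑ ε : ↥d.primeFactors → Bool, (∏ q, (if ε q then (-1 : ℤ) else 1)) *
            ({φ : K →+* ℂ | φ.comp (algebraMap F K) = τ.comp (∏ q, (if ε q then σ q else 1)).toRingEquiv.toRingHom ∧
              φ ∈ Φ.1}.ncard : ℤ) = 0) :
    ¬ IsNondegenerate Φ := by
  rw [isNondegenerate_iff_forall_intermediateField hodd hexp Φ]
  exact fun h => h.2 d hd hd1 F hdeg hF hcyc hS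

end Subfields

/-! ## §3 Consequences for abelian varieties: `B•(Aⁿ) ⊗ ℂ = D•(Aⁿ) ⊗ ℂ` and the Hodge conjecture for all powers off the subfield lists -/

section Varieties

open Literature.AlgebraicGeometry.Motives (AbelianVariety)
open Literature.AlgebraicGeometry.HodgeTheory
open Literature.AlgebraicGeometry.ComplexMultiplication (IsCMTypeRealisation)
open Literature.AlgebraicGeometry.VanGeemen1994 (hodgeClassSpan)
open Literature.Barriers.HodgeConjecture (divisorClassesSpan)
open _root_.CategoryTheory _root_.CategoryTheory.Limits

variable {K : Type} [Field K] [NumberField K] [IsCMField K] [IsAbelianGalois ℚ K] {m : ℕ}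
  {Φ : CMType K} {A : AbelianVariety ℂ} {ι : 𝓞 K →+* End A} {θ : K →+* Module.End ℂ (complexBetti A.X 1)}

/-- `Bᵐ ⊗ ℂ = Dᵐ ⊗ ℂ` for all `m` on an abelian variety gives the Hodge conjecture for it (Lefschetz `(1,1)`, cup products, tree theorems).
[cite: Gordon1999HodgeAVSurvey, §9.3] -/
private theorem hodgeConjectureFor_of_forall_hodgeClassSpan_eq_to (B : AbelianVariety ℂ)
    (h : ∀ n : ℕ, hodgeClassSpan B.dim B.X n = divisorClassesSpan B.X B.dim n) : HodgeConjectureFor B.dim B.X :=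
  ⟨nonempty_hodgeModel_holds (Motives.AbelianVariety.isSmoothProjective_holds (A := B)),
    fun n _ hc hmm ↦ AbelianVariety.divisorClassesSpan_le_algebraicClasses B
      (fun b hb hb' ↦ lefschetzOneOne_rational_holds (Motives.AbelianVariety.isSmoothProjective_holds (A := B)) b hb hb') n
      ((h n) ▸ Submodule.subset_span ⟨hc, hmm⟩)⟩

/-- **`B•(Aⁿ) ⊗ ℂ = D•(Aⁿ) ⊗ ℂ` FOR EVERY REALISATION OF A TYPE OFF THE SUBFIELD LISTS (`g^{2m} = 1` on `Gal`, `m` odd)**: if `Φ` is of Weil type over no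
imaginary quadratic subfield and, for every divisor `d ≠ 1` of `m`, has non-vanishing mixed differences along the prime torsion over every CM subfield of degree
`2d` with cyclic Galois group, then `Φ` is nondegenerate and all Hodge classes on all powers of every abelian variety of type `(K; Φ)` are generated by
divisor classes (tree `IsNondegenerate.hodgeClassSpan_pow_eq_divisorClassesSpan`). [cite: Kubota1965, §4 Lemma 2] [cite: Gordon1999HodgeAVSurvey, Thm. 6.4 and §9.3]
[cite: Hazama2003CyclicCM, Prop. 4.3 and Thm. 4.8] -/
theorem hodgeClassSpan_pow_eq_divisorClassesSpan_of_forall_intermediateField (hodd : ¬ 2 ∣ m) (hexp : ∀ g : K ≃ₐ[ℚ] K, g ^ (2 * m) = 1)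
    (hW : ∀ F : IntermediateField ℚ K, Module.finrank ℚ F = 2 → ¬ IsTotallyReal F →
        ¬ ∀ τ : F →+* ℂ, {φ : K →+* ℂ | φ.comp (algebraMap F K) = τ ∧ φ ∈ Φ.1}.ncard =
          {φ : K →+* ℂ | φ.comp (algebraMap F K) = τ ∧ φ ∉ Φ.1}.ncard)
    (hD : ∀ d : ℕ, d ∣ m → d ≠ 1 → ∀ F : IntermediateField ℚ K, Module.finrank ℚ F = 2 * d → ¬ IsTotallyReal F → IsCyclic (F ≃ₐ[ℚ] F) →
        ∀ [IsAbelianGalois ℚ F],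
        ¬ ∀ σ : ↥d.primeFactors → (F ≃ₐ[ℚ] F), (∀ q, σ q ^ (q : ℕ) = 1) → ∀ τ : F →+* ℂ,
          ∑ ε : ↥d.primeFactors → Bool, (∏ q, (if ε q then (-1 : ℤ) else 1)) *
            ({φ : K →+* ℂ | φ.comp (algebraMap F K) = τ.comp (∏ q, (if ε q then σ q else 1)).toRingEquiv.toRingHom ∧
              φ ∈ Φ.1}.ncard : ℤ) = 0)
    (hA : IsCMTypeRealisation Φ A ι θ) (n k : ℕ) :
    hodgeClassSpan (⨁ fun _ : Fin n => A).dim (⨁ fun _ : Fin n => A).X k =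
      divisorClassesSpan (⨁ fun _ : Fin n => A).X (⨁ fun _ : Fin n => A).dim k :=
  ((isNondegenerate_iff_forall_intermediateField hodd hexp Φ).2 ⟨hW, hD⟩).hodgeClassSpan_pow_eq_divisorClassesSpan hA n k

/-- **THE HODGE CONJECTURE FOR ALL POWERS OF EVERY REALISATION OF A TYPE OFF THE SUBFIELD LISTS (`g^{2m} = 1` on `Gal`, `m` odd)** — UNCONDITIONAL, any
realisation, hypotheses on the lattice of subfields only. [cite: Gordon1999HodgeAVSurvey, Thm. 6.4 and §9.3] [cite: Kubota1965, §4 Lemma 2] [cite: Deligne2000, §1] -/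
theorem hodgeConjectureFor_pow_of_forall_intermediateField (hodd : ¬ 2 ∣ m) (hexp : ∀ g : K ≃ₐ[ℚ] K, g ^ (2 * m) = 1)
    (hW : ∀ F : IntermediateField ℚ K, Module.finrank ℚ F = 2 → ¬ IsTotallyReal F →
        ¬ ∀ τ : F →+* ℂ, {φ : K →+* ℂ | φ.comp (algebraMap F K) = τ ∧ φ ∈ Φ.1}.ncard =
          {φ : K →+* ℂ | φ.comp (algebraMap F K) = τ ∧ φ ∉ Φ.1}.ncard)
    (hD : ∀ d : ℕ, d ∣ m → d ≠ 1 → ∀ F : IntermediateField ℚ K, Module.finrank ℚ F = 2 * d → ¬ IsTotallyReal F → IsCyclic (F ≃ₐ[ℚ] F) →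
        ∀ [IsAbelianGalois ℚ F],
        ¬ ∀ σ : ↥d.primeFactors → (F ≃ₐ[ℚ] F), (∀ q, σ q ^ (q : ℕ) = 1) → ∀ τ : F →+* ℂ,
          ∑ ε : ↥d.primeFactors → Bool, (∏ q, (if ε q then (-1 : ℤ) else 1)) *
            ({φ : K →+* ℂ | φ.comp (algebraMap F K) = τ.comp (∏ q, (if ε q then σ q else 1)).toRingEquiv.toRingHom ∧
              φ ∈ Φ.1}.ncard : ℤ) = 0)
    (hA : IsCMTypeRealisation Φ A ι θ) (n : ℕ) :
    HodgeConjectureFor (⨁ fun _ : Fin n => A).dim (⨁ fun _ : Fin n => A).X :=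
  hodgeConjectureFor_of_forall_hodgeClassSpan_eq_to _
    fun k ↦ hodgeClassSpan_pow_eq_divisorClassesSpan_of_forall_intermediateField hodd hexp hW hD hA n k

end Varieties

/-! ## §4 The cyclotomic fields `ℚ(ζ_N)` with `u^{2m} = 1` on `(ℤ/N)ˣ`, `m` odd; the levels `127, 151, 209, 324` -/

section Cyclotomic

open Literature.AlgebraicGeometry.Motives (AbelianVariety)
open Literature.AlgebraicGeometry.HodgeTheory
open Literature.AlgebraicGeometry.ComplexMultiplication (IsCMTypeRealisation)
open _root_.CategoryTheory _root_.CategoryTheory.Limits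

variable {N m : ℕ} {L : Type} [Field L] [NumberField L]
  {Φ : CMType L} {A : AbelianVariety ℂ} {ι : 𝓞 L →+* End A} {θ : L →+* Module.End ℂ (complexBetti A.X 1)}

/-- **The Hodge conjecture for all powers of every abelian variety with CM by `ℚ(ζ_N)`, `(ℤ/N)ˣ` of exponent dividing `2m` (`m` odd), whose type is off
the subfield lists** (Weil type over no imaginary quadratic subfield; non-vanishing mixed differences along the prime torsion over every CM subfield of
degree `2d`, `1 ≠ d ∣ m`, with cyclic Galois group).  Instance hypotheses `[IsCMField L] [IsAbelianGalois ℚ L]` as in the neighbours (true for `ℚ(ζ_N)`,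
`N > 2`, tree `cm_abelian_pow_eq_one_of_isCyclotomicExtension`). [cite: Gordon1999HodgeAVSurvey, Thm. 6.4 and §9.3] [cite: Washington1997, Ch. 2 Thm. 2.5] -/
theorem hodgeConjectureFor_pow_of_forall_intermediateField_of_isCyclotomicExtension [NeZero N] [IsCyclotomicExtension {N} ℚ L]
    [IsCMField L] [IsAbelianGalois ℚ L] (h2N : 2 < N) (hodd : ¬ 2 ∣ m) (hN : ∀ u : (ZMod N)ˣ, u ^ (2 * m) = 1)
    (hW : ∀ F : IntermediateField ℚ L, Module.finrank ℚ F = 2 → ¬ IsTotallyReal F →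
        ¬ ∀ τ : F →+* ℂ, {φ : L →+* ℂ | φ.comp (algebraMap F L) = τ ∧ φ ∈ Φ.1}.ncard =
          {φ : L →+* ℂ | φ.comp (algebraMap F L) = τ ∧ φ ∉ Φ.1}.ncard)
    (hD : ∀ d : ℕ, d ∣ m → d ≠ 1 → ∀ F : IntermediateField ℚ L, Module.finrank ℚ F = 2 * d → ¬ IsTotallyReal F → IsCyclic (F ≃ₐ[ℚ] F) →
        ∀ [IsAbelianGalois ℚ F],
        ¬ ∀ σ : ↥d.primeFactors → (F ≃ₐ[ℚ] F), (∀ q, σ q ^ (q : ℕ) = 1) → ∀ τ : F →+* ℂ,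
          ∑ ε : ↥d.primeFactors → Bool, (∏ q, (if ε q then (-1 : ℤ) else 1)) *
            ({φ : L →+* ℂ | φ.comp (algebraMap F L) = τ.comp (∏ q, (if ε q then σ q else 1)).toRingEquiv.toRingHom ∧
              φ ∈ Φ.1}.ncard : ℤ) = 0)
    (hA : IsCMTypeRealisation Φ A ι θ) (n : ℕ) :
    HodgeConjectureFor (⨁ fun _ : Fin n => A).dim (⨁ fun _ : Fin n => A).X :=
  hodgeConjectureFor_pow_of_forall_intermediateField hodd (cm_abelian_pow_eq_one_of_isCyclotomicExtension h2N hN L).2.2.1 hW hD hA n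

/-! ### The levels `127` (`ℤ/126`, `m = 63 = 3²·7`), `151` (`ℤ/150`, `m = 75 = 3·5²`), `209` (`ℤ/10 × ℤ/18`, `m = 45`), `324` (`ℤ/2 × ℤ/54`, `m = 27`):
the first cyclotomic fields whose odd exponent part is neither squarefree nor the square of a prime -/

/-- `u¹²⁶ = 1` for every unit of `ℤ/127` (`127` prime; kernel decision on residues). [cite: Washington1997, Ch. 2 Thm. 2.5] -/
theorem units_pow_oneHundredTwentySix_oneHundredTwentySeven (u : (ZMod 127)ˣ) : u ^ (2 * 63) = 1 := by
  have h : ∀ a : ZMod 127, Nat.Coprime a.val 127 → a ^ 126 = 1 := by decide +kernel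
  exact Units.ext (by rw [Units.val_pow_eq_pow_val, h _ (ZMod.val_coe_unit_coprime u), Units.val_one])

/-- `u¹⁵⁰ = 1` for every unit of `ℤ/151` (`151` prime). [cite: Washington1997, Ch. 2 Thm. 2.5] -/
theorem units_pow_oneHundredFifty_oneHundredFiftyOne (u : (ZMod 151)ˣ) : u ^ (2 * 75) = 1 := by
  have h : ∀ a : ZMod 151, Nat.Coprime a.val 151 → a ^ 150 = 1 := by decide +kernel
  exact Units.ext (by rw [Units.val_pow_eq_pow_val, h _ (ZMod.val_coe_unit_coprime u), Units.val_one])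

/-- `u⁹⁰ = 1` for every unit of `ℤ/209` (`209 = 11·19`, `(ℤ/209)ˣ ≅ ℤ/10 × ℤ/18` of exponent `90`). [cite: Washington1997, Ch. 2 Thm. 2.5] -/
theorem units_pow_ninety_twoHundredNine (u : (ZMod 209)ˣ) : u ^ (2 * 45) = 1 := by
  have h : ∀ a : ZMod 209, Nat.Coprime a.val 209 → a ^ 90 = 1 := by decide +kernel
  exact Units.ext (by rw [Units.val_pow_eq_pow_val, h _ (ZMod.val_coe_unit_coprime u), Units.val_one])

/-- `u⁵⁴ = 1` for every unit of `ℤ/324` (`324 = 4·81`, `(ℤ/324)ˣ ≅ ℤ/2 × ℤ/54` of exponent `54`). [cite: Washington1997, Ch. 2 Thm. 2.5] -/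
theorem units_pow_fiftyFour_threeHundredTwentyFour (u : (ZMod 324)ˣ) : u ^ (2 * 27) = 1 := by
  have h : ∀ a : ZMod 324, Nat.Coprime a.val 324 → a ^ 54 = 1 := by decide +kernel
  exact Units.ext (by rw [Units.val_pow_eq_pow_val, h _ (ZMod.val_coe_unit_coprime u), Units.val_one])

/-- **`ℚ(ζ₁₂₇)`: THE HODGE CONJECTURE FOR ALL POWERS of every abelian variety with complex multiplication by `ℚ(ζ₁₂₇)` (CM `63`-folds; `Gal ≅ ℤ/126`,
`126 = 2·3²·7`) whose type is NOT of Weil type over the imaginary quadratic subfield `ℚ(√−127)` and has non-vanishing mixed differences along the prime torsion over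
every CM subfield of degree `2d`, `d ∈ {3, 7, 9, 21, 63}`** (one CM subfield per degree, all with cyclic Galois group) — UNCONDITIONAL.
[cite: Gordon1999HodgeAVSurvey, Thm. 6.4 and §9.3] [cite: Kubota1965, §4 Lemma 2] [cite: Hazama2003CyclicCM, Thm. 4.8] [cite: Washington1997, Ch. 2 Thm. 2.5] -/
theorem hodgeConjectureFor_pow_of_forall_intermediateField_oneHundredTwentySeven [IsCyclotomicExtension {127} ℚ L] [IsCMField L]
    [IsAbelianGalois ℚ L]
    (hW : ∀ F : IntermediateField ℚ L, Module.finrank ℚ F = 2 → ¬ IsTotallyReal F →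
        ¬ ∀ τ : F →+* ℂ, {φ : L →+* ℂ | φ.comp (algebraMap F L) = τ ∧ φ ∈ Φ.1}.ncard =
          {φ : L →+* ℂ | φ.comp (algebraMap F L) = τ ∧ φ ∉ Φ.1}.ncard)
    (hD : ∀ d : ℕ, d ∣ 63 → d ≠ 1 → ∀ F : IntermediateField ℚ L, Module.finrank ℚ F = 2 * d → ¬ IsTotallyReal F → IsCyclic (F ≃ₐ[ℚ] F) →
        ∀ [IsAbelianGalois ℚ F],
        ¬ ∀ σ : ↥d.primeFactors → (F ≃ₐ[ℚ] F), (∀ q, σ q ^ (q : ℕ) = 1) → ∀ τ : F →+* ℂ,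
          ∑ ε : ↥d.primeFactors → Bool, (∏ q, (if ε q then (-1 : ℤ) else 1)) *
            ({φ : L →+* ℂ | φ.comp (algebraMap F L) = τ.comp (∏ q, (if ε q then σ q else 1)).toRingEquiv.toRingHom ∧
              φ ∈ Φ.1}.ncard : ℤ) = 0)
    (hA : IsCMTypeRealisation Φ A ι θ) (n : ℕ) :
    HodgeConjectureFor (⨁ fun _ : Fin n => A).dim (⨁ fun _ : Fin n => A).X :=
  haveI : NeZero (127 : ℕ) := ⟨by norm_num⟩
  hodgeConjectureFor_pow_of_forall_intermediateField_of_isCyclotomicExtension (N := 127) (m := 63) (by norm_num) (by norm_num)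
    units_pow_oneHundredTwentySix_oneHundredTwentySeven hW hD hA n

/-- **`ℚ(ζ₁₅₁)`** (CM `75`-folds; `Gal ≅ ℤ/150`, `150 = 2·3·5²`; divisor classes `d ∈ {3, 5, 15, 25, 75}`): the Hodge conjecture for all powers of every
abelian variety of a type off the subfield lists — UNCONDITIONAL. [cite: Gordon1999HodgeAVSurvey, Thm. 6.4 and §9.3] [cite: Kubota1965, §4 Lemma 2]
[cite: Hazama2003CyclicCM, Thm. 4.8] [cite: Washington1997, Ch. 2 Thm. 2.5] -/
theorem hodgeConjectureFor_pow_of_forall_intermediateField_oneHundredFiftyOne [IsCyclotomicExtension {151} ℚ L] [IsCMField L]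
    [IsAbelianGalois ℚ L]
    (hW : ∀ F : IntermediateField ℚ L, Module.finrank ℚ F = 2 → ¬ IsTotallyReal F →
        ¬ ∀ τ : F →+* ℂ, {φ : L →+* ℂ | φ.comp (algebraMap F L) = τ ∧ φ ∈ Φ.1}.ncard =
          {φ : L →+* ℂ | φ.comp (algebraMap F L) = τ ∧ φ ∉ Φ.1}.ncard)
    (hD : ∀ d : ℕ, d ∣ 75 → d ≠ 1 → ∀ F : IntermediateField ℚ L, Module.finrank ℚ F = 2 * d → ¬ IsTotallyReal F → IsCyclic (F ≃ₐ[ℚ] F) →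
        ∀ [IsAbelianGalois ℚ F],
        ¬ ∀ σ : ↥d.primeFactors → (F ≃ₐ[ℚ] F), (∀ q, σ q ^ (q : ℕ) = 1) → ∀ τ : F →+* ℂ,
          ∑ ε : ↥d.primeFactors → Bool, (∏ q, (if ε q then (-1 : ℤ) else 1)) *
            ({φ : L →+* ℂ | φ.comp (algebraMap F L) = τ.comp (∏ q, (if ε q then σ q else 1)).toRingEquiv.toRingHom ∧
              φ ∈ Φ.1}.ncard : ℤ) = 0)
    (hA : IsCMTypeRealisation Φ A ι θ) (n : ℕ) :
    HodgeConjectureFor (⨁ fun _ : Fin n => A).dim (⨁ fun _ : Fin n => A).X :=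
  haveI : NeZero (151 : ℕ) := ⟨by norm_num⟩
  hodgeConjectureFor_pow_of_forall_intermediateField_of_isCyclotomicExtension (N := 151) (m := 75) (by norm_num) (by norm_num)
    units_pow_oneHundredFifty_oneHundredFiftyOne hW hD hA n

/-- **`ℚ(ζ₂₀₉)`** (CM `90`-folds; `209 = 11·19`, `Gal ≅ ℤ/10 × ℤ/18` — NOT cyclic — of exponent `90 = 2·3²·5`; divisor classes `d ∈ {3, 5, 9, 15, 45}`): the
Hodge conjecture for all powers of every abelian variety of a type off the subfield lists — UNCONDITIONAL. [cite: Gordon1999HodgeAVSurvey, Thm. 6.4 and §9.3]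
[cite: Kubota1965, §4 Lemma 2] [cite: Washington1997, Ch. 2 Thm. 2.5] -/
theorem hodgeConjectureFor_pow_of_forall_intermediateField_twoHundredNine [IsCyclotomicExtension {209} ℚ L] [IsCMField L]
    [IsAbelianGalois ℚ L]
    (hW : ∀ F : IntermediateField ℚ L, Module.finrank ℚ F = 2 → ¬ IsTotallyReal F →
        ¬ ∀ τ : F →+* ℂ, {φ : L →+* ℂ | φ.comp (algebraMap F L) = τ ∧ φ ∈ Φ.1}.ncard =
          {φ : L →+* ℂ | φ.comp (algebraMap F L) = τ ∧ φ ∉ Φ.1}.ncard)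
    (hD : ∀ d : ℕ, d ∣ 45 → d ≠ 1 → ∀ F : IntermediateField ℚ L, Module.finrank ℚ F = 2 * d → ¬ IsTotallyReal F → IsCyclic (F ≃ₐ[ℚ] F) →
        ∀ [IsAbelianGalois ℚ F],
        ¬ ∀ σ : ↥d.primeFactors → (F ≃ₐ[ℚ] F), (∀ q, σ q ^ (q : ℕ) = 1) → ∀ τ : F →+* ℂ,
          ∑ ε : ↥d.primeFactors → Bool, (∏ q, (if ε q then (-1 : ℤ) else 1)) *
            ({φ : L →+* ℂ | φ.comp (algebraMap F L) = τ.comp (∏ q, (if ε q then σ q else 1)).toRingEquiv.toRingHom ∧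
              φ ∈ Φ.1}.ncard : ℤ) = 0)
    (hA : IsCMTypeRealisation Φ A ι θ) (n : ℕ) :
    HodgeConjectureFor (⨁ fun _ : Fin n => A).dim (⨁ fun _ : Fin n => A).X :=
  haveI : NeZero (209 : ℕ) := ⟨by norm_num⟩
  hodgeConjectureFor_pow_of_forall_intermediateField_of_isCyclotomicExtension (N := 209) (m := 45) (by norm_num) (by norm_num)
    units_pow_ninety_twoHundredNine hW hD hA n

/-- **`ℚ(ζ₃₂₄)`** (CM `54`-folds; `324 = 4·3⁴`, `Gal ≅ ℤ/2 × ℤ/54` of exponent `54 = 2·3³`; divisor classes `d ∈ {3, 9, 27}`): the Hodge conjecture for all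
powers of every abelian variety of a type off the subfield lists — UNCONDITIONAL. [cite: Gordon1999HodgeAVSurvey, Thm. 6.4 and §9.3] [cite: Kubota1965, §4 Lemma 2]
[cite: Washington1997, Ch. 2 Thm. 2.5] -/
theorem hodgeConjectureFor_pow_of_forall_intermediateField_threeHundredTwentyFour [IsCyclotomicExtension {324} ℚ L] [IsCMField L]
    [IsAbelianGalois ℚ L]
    (hW : ∀ F : IntermediateField ℚ L, Module.finrank ℚ F = 2 → ¬ IsTotallyReal F →
        ¬ ∀ τ : F →+* ℂ, {φ : L →+* ℂ | φ.comp (algebraMap F L) = τ ∧ φ ∈ Φ.1}.ncard =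
          {φ : L →+* ℂ | φ.comp (algebraMap F L) = τ ∧ φ ∉ Φ.1}.ncard)
    (hD : ∀ d : ℕ, d ∣ 27 → d ≠ 1 → ∀ F : IntermediateField ℚ L, Module.finrank ℚ F = 2 * d → ¬ IsTotallyReal F → IsCyclic (F ≃ₐ[ℚ] F) →
        ∀ [IsAbelianGalois ℚ F],
        ¬ ∀ σ : ↥d.primeFactors → (F ≃ₐ[ℚ] F), (∀ q, σ q ^ (q : ℕ) = 1) → ∀ τ : F →+* ℂ,
          ∑ ε : ↥d.primeFactors → Bool, (∏ q, (if ε q then (-1 : ℤ) else 1)) *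
            ({φ : L →+* ℂ | φ.comp (algebraMap F L) = τ.comp (∏ q, (if ε q then σ q else 1)).toRingEquiv.toRingHom ∧
              φ ∈ Φ.1}.ncard : ℤ) = 0)
    (hA : IsCMTypeRealisation Φ A ι θ) (n : ℕ) :
    HodgeConjectureFor (⨁ fun _ : Fin n => A).dim (⨁ fun _ : Fin n => A).X :=
  haveI : NeZero (324 : ℕ) := ⟨by norm_num⟩
  hodgeConjectureFor_pow_of_forall_intermediateField_of_isCyclotomicExtension (N := 324) (m := 27) (by norm_num) (by norm_num)
    units_pow_fiftyFour_threeHundredTwentyFour hW hD hA n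

end Cyclotomic

end ExponentTwiceOdd

end Literature.AlgebraicGeometry.Pohlmann1968
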